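import Summits.Ventures.Crystal3D.Theorems.StickyWulffConstantCoaxialWallLawTailResidueModuleCaptureShallow
import Summits.Ventures.Crystal3D.Theorems.StickyWulffConstantCoaxialWallLawTerracePropagation
import Summits.Ventures.Crystal3D.Theorems.StickyWulffConstantCoaxialWallLawEndRowOuterShell
import Summits.Ventures.Crystal3D.Theorems.StickyWulffConstantGenericWallFloorCredits
import HarnessLib

/-!
# ONE JAMMED BALL: a ball with at most three contacts, sitting at no inspected position, only shrinks pools — it never reads
# (crux `CoaxialWallLaw`, stmt-Ventures-19481, line `WallLedgerF`; census-free reduction for universe U-A1 of `stub_multiGrainSmallHigh`)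

HONEST FRAMING. Venture `Summits/Ventures/Crystal3D` (cell `crystal3d-full`), helper `--supports` the crux `CoaxialWallLaw` of
`route-Ventures-StickyWulffConstant` (REGISTERED line `WallLedgerF`, skeleton 'CoaxialWallLawCertificates' v4, open stub `stub_multiGrainSmallHigh :
KissingGap (5/2) → KissingClassification (5/2) → TailResidue.MultiGrainSmallHigh (2√6) 3`).  Rung credit only; F-C1 not moved; census-free.
Memo HOME/wall-19481-p2/F-TAIL-g10.md §10–§11, universe U-A1 «on-site window + ONE jammed dust ball»: by `…LatticeContacts` / `…ModuleContactsBarlow`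
a non-module ball touches `≤ 3` balls of a crystallite / Barlow window.  THIS FILE is the census-free comparison between `X` and `X.erase x` for such
a ball `x` — the companion of `…DustDeletion` (which deletes balls touching NOTHING near the payer):
* `four_le_card_contacts` — bookkeeping: four distinct contacts;
* **`not_isEndPairA_of_card_contacts_le_three`** — a ball with `≤ 3` contacts is never an (A)-predecessor (a full reading needs `12`, a narrow
  one the upper triple plus the predecessor, a twin one the lower triple plus a mirror ball: `≥ 4` contacts each; `exists_far_frame`);
* **`isEndPairA_erase_of_not_inspected`**, **`endMultA_le_erase`** — if `x` sits at no inspected position of the (A)-end pairs of `b` in `X`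
  (no dozen / mirrored-dozen position of the reader or of `b`), then every (A)-end pair of `b` in `X` is one of `b` in `X.erase x`
  (`isEndMove_of_exact`, and the two-payer clause survives because a ball touching `x` has degree `≤ 11` without it);
* **`pooledDef_erase_le`** — `pooledDef (X.erase x) b ≤ pooledDef X b + #{y ∈ X.erase x : dist x y = 1, dist b y ≤ 1}`: removing `x` un-heals
  one unit at each of its contacts and nothing else (`x` itself only ADDS to pools of `X`);
* **`localSummandA_le_of_jammed`** — hence `Σ_A(X, z) ≤ Σ_{b} e_{X∖x}(b) / (p_{X∖x}(b) − c_x(b))`, `c_x(b) ≤ 3` the number of contacts of `x` within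
  `1` of `b`: the certificate for U-A1 is a re-evaluation of the ON-SITE window `X.erase x` with pools lowered by `≤ 3` near the contact triple.
WHAT THIS IS NOT: not the census, not the stub; F-C1 not moved.
-/

noncomputable section

namespace Summit.Ventures.Crystal3D.Theorems

namespace TailResidue

open Summit.Ventures.Crystal3D Finset
open scoped InnerProductSpace

section Jammed

variable {X : Finset (EuclideanSpace ℝ (Fin 3))} {v : WordVersion} {S₁ S₂ : PlateSystem}

open scoped Classical in
/-- Four distinct balls at distance `1` from `x` give `4 ≤ #contacts`. -/
theorem four_le_card_contacts {x p₁ p₂ p₃ p₄ : EuclideanSpace ℝ (Fin 3)} (h₁ : p₁ ∈ X) (h₂ : p₂ ∈ X) (h₃ : p₃ ∈ X) (h₄ : p₄ ∈ X)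
    (d₁ : dist x p₁ = 1) (d₂ : dist x p₂ = 1) (d₃ : dist x p₃ = 1) (d₄ : dist x p₄ = 1)
    (n₁₂ : p₁ ≠ p₂) (n₁₃ : p₁ ≠ p₃) (n₁₄ : p₁ ≠ p₄) (n₂₃ : p₂ ≠ p₃) (n₂₄ : p₂ ≠ p₄) (n₃₄ : p₃ ≠ p₄) :
    4 ≤ (X.filter fun q => dist x q = 1).card := by
  have hsub : ({p₁, p₂, p₃, p₄} : Finset (EuclideanSpace ℝ (Fin 3))) ⊆ X.filter fun q => dist x q = 1 := by
    intro p hp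
    simp only [mem_insert, mem_singleton] at hp
    rcases hp with rfl | rfl | rfl | rfl
    · exact mem_filter.2 ⟨h₁, d₁⟩
    · exact mem_filter.2 ⟨h₂, d₂⟩
    · exact mem_filter.2 ⟨h₃, d₃⟩
    · exact mem_filter.2 ⟨h₄, d₄⟩
  have hcard : ({p₁, p₂, p₃, p₄} : Finset (EuclideanSpace ℝ (Fin 3))).card = 4 := by
    rw [card_insert_of_notMem (by simp [n₁₂, n₁₃, n₁₄]), card_insert_of_notMem (by simp [n₂₃, n₂₄]),
      card_insert_of_notMem (by simp [n₃₄]), card_singleton]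
  exact hcard ▸ card_le_card hsub

/-- The distance from `x` to `x + u` is `‖u‖`. -/
theorem dist_add_right_eq (x u : EuclideanSpace ℝ (Fin 3)) : dist x (x + u) = ‖u‖ := by
  rw [dist_eq_norm, sub_add_cancel_left, norm_neg]

/-- The direction of an admissible class of a system with slot roots is `± G w` for slots `w`. -/
theorem exists_slots_of_adm {S : PlateSystem} (hS : S.RT ⊆ fccSlots) {G : EuclideanSpace ℝ (Fin 3) ≃ₗᵢ[ℝ] EuclideanSpace ℝ (Fin 3)}
    {d : EuclideanSpace ℝ (Fin 3)} (h : S.Adm G d) : (∃ w ∈ fccSlots, d = G w) ∧ (∃ w ∈ fccSlots, -d = G w) := by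
  obtain ⟨r, hr, κ, -, hG, hd⟩ := h
  have hr' : r ∈ fccSlots := hS hr
  rcases neg_one_pow_eq_or ℝ κ.length with h1 | h1
  · refine ⟨⟨r, hr', by rw [hd, hG, h1, one_smul]⟩, ⟨-r, neg_mem_fccSlots hr', by rw [hd, hG, h1, one_smul, map_neg]⟩⟩
  · refine ⟨⟨-r, neg_mem_fccSlots hr', by rw [hd, hG, h1, neg_smul, one_smul, map_neg]⟩,
      ⟨r, hr', by rw [hd, hG, h1, neg_smul, one_smul, map_neg, neg_neg]⟩⟩

/-- **A ball with at most three contacts is never an (A)-predecessor** (plate systems with slot roots). -/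
theorem not_isEndPairA_of_card_contacts_le_three (h₁ : S₁.RT ⊆ fccSlots) (h₂ : S₂.RT ⊆ fccSlots) {x : EuclideanSpace ℝ (Fin 3)}
    (hfew : (X.filter fun q => dist x q = 1).card ≤ 3) (b : EuclideanSpace ℝ (Fin 3)) : ¬ IsEndPairA X v S₁ S₂ b x := by
  classical
  rintro ⟨hxX, -, -, G, d, hadm, hpred, hmove⟩
  -- the direction is the image of a slot: `d = G w₀`
  obtain ⟨w₀, hw₀, hdw⟩ : ∃ w₀ ∈ fccSlots, d = G w₀ := by
    rcases hadm with h | h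
    · exact (exists_slots_of_adm h₁ h).1
    · exact (exists_slots_of_adm h₂ h).1
  have hd1 : ‖d‖ = 1 := by rw [hdw, LinearIsometryEquiv.norm_map]; exact norm_eq_one_of_mem_fccSlots hw₀
  have hrt : 0 < Real.sqrt (2 / 3) := Real.sqrt_pos.2 (by norm_num)
  have dslot : ∀ w ∈ fccSlots, dist x (x + G w) = 1 := fun w hw => by
    rw [dist_add_right_eq, LinearIsometryEquiv.norm_map]; exact norm_eq_one_of_mem_fccSlots hw
  have Ginj : ∀ {w w' : EuclideanSpace ℝ (Fin 3)}, x + G w = x + G w' → w = w' := fun h => G.injective (add_left_cancel h)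
  -- a FULL reading at `x` needs twelve contacts
  have notFull : ¬ IsFull X G x := by
    intro hf
    have hsub : fccSlots.image (fun w => x + G w) ⊆ X.filter fun q => dist x q = 1 := by
      intro p hp
      obtain ⟨w, hw, rfl⟩ := mem_image.1 hp
      exact mem_filter.2 ⟨hf w hw, dslot w hw⟩
    have hc := card_le_card hsub
    rw [card_image_of_injective _ (fun w w' h => Ginj h), card_fccSlots] at hc
    omega
  -- a TWIN reading at `x` needs the lower triple and a mirror ball
  have notTwin : ∀ m, ¬ IsTwinReading X G m x := by
    rintro m ⟨hm, hlow, hmir, -⟩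
    obtain ⟨u₁, hu₁, u₂, hu₂, u₃, hu₃, n₁, n₂, n₃, i₁₂, i₁₃, i₂₃, -, -⟩ := exists_far_frame G hm.1 hm.2
    have hneg : ∀ u ∈ fccSlots, ⟪G u, m⟫_ℝ = Real.sqrt (2 / 3) → ⟪G (-u), m⟫_ℝ < 0 := fun u _ hu => by
      rw [map_neg, inner_neg_left, hu]; linarith
    have m₁ := hlow (-u₁) (neg_mem_fccSlots hu₁) (hneg u₁ hu₁ n₁).le
    have m₂ := hlow (-u₂) (neg_mem_fccSlots hu₂) (hneg u₂ hu₂ n₂).le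
    have m₃ := hlow (-u₃) (neg_mem_fccSlots hu₃) (hneg u₃ hu₃ n₃).le
    have m₄ := hmir (-u₁) (neg_mem_fccSlots hu₁) (hneg u₁ hu₁ n₁)
    -- distinctness
    have hne : ∀ {u u' : EuclideanSpace ℝ (Fin 3)}, ⟪u, u'⟫_ℝ = 1 / 2 → u ∈ fccSlots → x + G (-u) ≠ x + G (-u') := by
      intro u u' hi hu h
      have := Ginj h
      rw [neg_inj] at this
      rw [this, real_inner_self_eq_norm_sq, norm_eq_one_of_mem_fccSlots (this ▸ hu)] at hi
      norm_num at hi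
    have hmirpos : ⟪G (-u₁) - (2 * ⟪G (-u₁), m⟫_ℝ) • m, m⟫_ℝ = Real.sqrt (2 / 3) := by
      rw [inner_sub_left, inner_smul_left, real_inner_self_eq_norm_sq, hm.1, map_neg, inner_neg_left, n₁]
      simp; ring
    have hne4 : ∀ u ∈ fccSlots, ⟪G u, m⟫_ℝ = Real.sqrt (2 / 3) → x + G (-u) ≠ x + (G (-u₁) - (2 * ⟪G (-u₁), m⟫_ℝ) • m) := by
      intro u hu hn h
      have h' := add_left_cancel h
      have key : ⟪G (-u), m⟫_ℝ = ⟪G (-u₁) - (2 * ⟪G (-u₁), m⟫_ℝ) • m, m⟫_ℝ := by rw [h']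
      rw [hmirpos, map_neg, inner_neg_left, hn] at key
      linarith
    have hc := four_le_card_contacts m₁ m₂ m₃ m₄ (dslot _ (neg_mem_fccSlots hu₁)) (dslot _ (neg_mem_fccSlots hu₂))
      (dslot _ (neg_mem_fccSlots hu₃))
      (by rw [dist_add_right_eq]; exact norm_sub_two_inner_smul_eq_one (by rw [LinearIsometryEquiv.norm_map]; exact norm_eq_one_of_mem_fccSlots (neg_mem_fccSlots hu₁)) hm.1)
      (hne i₁₂ hu₁) (hne i₁₃ hu₁) (hne4 u₁ hu₁ n₁) (hne i₂₃ hu₂) (hne4 u₂ hu₂ n₂) (hne4 u₃ hu₃ n₃)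
    omega
  -- a NARROW reading at `x` needs the upper triple and the predecessor
  have notNarrow : ¬ IsNarrow X G d x := by
    rintro ⟨-, m, hm, hdm, htr⟩
    obtain ⟨u₁, hu₁, u₂, hu₂, u₃, hu₃, n₁, n₂, n₃, i₁₂, i₁₃, i₂₃, -, -⟩ := exists_far_frame G hm.1 hm.2
    have hpos : ∀ u, ⟪G u, m⟫_ℝ = Real.sqrt (2 / 3) → 0 < ⟪G u, m⟫_ℝ := fun u hu => by rw [hu]; exact hrt
    have m₁ := htr u₁ hu₁ (hpos u₁ n₁)
    have m₂ := htr u₂ hu₂ (hpos u₂ n₂)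
    have m₃ := htr u₃ hu₃ (hpos u₃ n₃)
    have m₄ : x + G (-w₀) ∈ X := by rw [map_neg, ← sub_eq_add_neg, ← hdw]; exact hpred
    have hne : ∀ {u u' : EuclideanSpace ℝ (Fin 3)}, ⟪u, u'⟫_ℝ = 1 / 2 → u ∈ fccSlots → x + G u ≠ x + G u' := by
      intro u u' hi hu h
      have := Ginj h
      rw [this, real_inner_self_eq_norm_sq, norm_eq_one_of_mem_fccSlots (this ▸ hu)] at hi
      norm_num at hi
    have hne4 : ∀ u, ⟪G u, m⟫_ℝ = Real.sqrt (2 / 3) → x + G u ≠ x + G (-w₀) := by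
      intro u hn h
      have := Ginj h
      rw [this, map_neg, inner_neg_left, ← hdw, hdm] at hn
      linarith
    have hc := four_le_card_contacts m₁ m₂ m₃ m₄ (dslot u₁ hu₁) (dslot u₂ hu₂) (dslot u₃ hu₃) (dslot _ (neg_mem_fccSlots hw₀))
      (hne i₁₂ hu₁) (hne i₁₃ hu₁) (hne4 u₁ n₁) (hne i₂₃ hu₂) (hne4 u₂ n₂) (hne4 u₃ n₃)
    omega
  rcases hmove with ⟨hrd, -, -⟩ | ⟨m, htw, -, -, -⟩
  · rcases hrd with hf | ⟨-, hn⟩ | ⟨m, htw, -⟩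
    · exact notFull hf
    · exact notNarrow hn
    · exact notTwin m htw
  · exact notTwin m htw

open scoped Classical in
/-- **An (A)-end pair survives the removal of an uninspected ball.**  If `x ≠ b` is not the predecessor `q`, sits at no inspected position of the
pair `(b, q)` in its class, then `(b, q)` is an (A)-end pair of `X.erase x` as well. -/
theorem isEndPairA_erase_of_not_inspected (hX : ∀ p ∈ X, ∀ q ∈ X, p ≠ q → 1 ≤ dist p q) (h₁ : S₁.RT ⊆ fccSlots)
    (h₂ : S₂.RT ⊆ fccSlots) {x b q : EuclideanSpace ℝ (Fin 3)} (hbx : b ≠ x) (hqx : q ≠ x)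
    (hnot : ∀ G d, (S₁.Adm G d ∨ S₂.Adm G d) → IsEndMove X v G d q b → ¬ InspectedAt G q b x)
    (h : IsEndPairA X v S₁ S₂ b q) : IsEndPairA (X.erase x) v S₁ S₂ b q := by
  obtain ⟨hq, hb, hpay, G, d, hadm, hpred, hmove⟩ := h
  have hni := hnot G d hadm hmove
  have hbE : b ∈ X.erase x := mem_erase.2 ⟨hbx, hb⟩
  refine ⟨mem_erase.2 ⟨hqx, hq⟩, hbE, ?_, G, d, hadm, ?_, ?_⟩
  · -- the two-payer clause survives: degrees only drop, and a ball touching `x` has degree `≤ 11` without it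
    have hdeg : ∀ y, ((X.erase x).filter fun q => dist y q = 1).card ≤ (X.filter fun q => dist y q = 1).card :=
      fun y => card_le_card (fun p hp => by rw [mem_filter] at hp ⊢; exact ⟨(mem_erase.1 hp.1).2, hp.2⟩)
    rcases hpay with hle | ⟨z₁, hz₁, z₂, hz₂, hne, hd₁, hd₂, hdeg₁, hdeg₂⟩
    · exact Or.inl ((hdeg b).trans hle)
    · by_cases hx₁ : z₁ = x
      · -- `x` touches `b`: in `X.erase x` the ball `b` is deficient
        left
        subst hx₁
        have hxmem : z₁ ∈ X.filter fun q => dist b q = 1 := mem_filter.2 ⟨hz₁, hd₁⟩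
        have hsub : (X.erase z₁).filter (fun q => dist b q = 1) ⊆ (X.filter fun q => dist b q = 1).erase z₁ := by
          intro p hp; rw [mem_filter] at hp; exact mem_erase.2 ⟨(mem_erase.1 hp.1).1, mem_filter.2 ⟨(mem_erase.1 hp.1).2, hp.2⟩⟩
        have h12 := card_filter_dist_eq_one_le_twelve X hX b
        have hc := card_le_card hsub
        rw [card_erase_of_mem hxmem] at hc
        omega
      by_cases hx₂ : z₂ = x
      · left
        subst hx₂
        have hxmem : z₂ ∈ X.filter fun q => dist b q = 1 := mem_filter.2 ⟨hz₂, hd₂⟩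
        have hsub : (X.erase z₂).filter (fun q => dist b q = 1) ⊆ (X.filter fun q => dist b q = 1).erase z₂ := by
          intro p hp; rw [mem_filter] at hp; exact mem_erase.2 ⟨(mem_erase.1 hp.1).1, mem_filter.2 ⟨(mem_erase.1 hp.1).2, hp.2⟩⟩
        have h12 := card_filter_dist_eq_one_le_twelve X hX b
        have hc := card_le_card hsub
        rw [card_erase_of_mem hxmem] at hc
        omega
      · exact Or.inr ⟨z₁, mem_erase.2 ⟨hx₁, hz₁⟩, z₂, mem_erase.2 ⟨hx₂, hz₂⟩, hne, hd₁, hd₂, (hdeg z₁).trans hdeg₁, (hdeg z₂).trans hdeg₂⟩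
  · -- the predecessor is a dozen position of `q`, hence not `x`
    refine mem_erase.2 ⟨fun h => hni ?_, hpred⟩
    obtain ⟨w₀, hw₀, hdw⟩ : ∃ w₀ ∈ fccSlots, -d = G w₀ := by
      rcases hadm with h | h
      · exact (exists_slots_of_adm h₁ h).2
      · exact (exists_slots_of_adm h₂ h).2
    exact ⟨w₀, hw₀, Or.inl (by rw [← h, sub_eq_add_neg, hdw])⟩
  · exact isEndMove_of_exact (erase_subset x X) hmove hbE fun y hy hiy => mem_erase.2 ⟨fun h => hni (h ▸ hiy), hy⟩


open scoped Classical in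
/-- **End pairs only gain when an uninspected ball with few contacts is removed**: `endMultA X b ≤ endMultA (X.erase x) b`. -/
theorem endMultA_le_erase (hX : ∀ p ∈ X, ∀ q ∈ X, p ≠ q → 1 ≤ dist p q) (h₁ : S₁.RT ⊆ fccSlots) (h₂ : S₂.RT ⊆ fccSlots)
    {x b : EuclideanSpace ℝ (Fin 3)} (hbx : b ≠ x) (hfew : (X.filter fun q => dist x q = 1).card ≤ 3)
    (hnot : ∀ q ∈ X, ∀ G d, (S₁.Adm G d ∨ S₂.Adm G d) → IsEndMove X v G d q b → ¬ InspectedAt G q b x) :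
    endMultA X v S₁ S₂ b ≤ endMultA (X.erase x) v S₁ S₂ b := by
  unfold endMultA
  refine card_le_card fun q hq => ?_
  rw [mem_filter] at hq ⊢
  have hqx : q ≠ x := fun h => not_isEndPairA_of_card_contacts_le_three (v := v) h₁ h₂ hfew b (h ▸ hq.2)
  exact ⟨mem_erase.2 ⟨hqx, hq.1⟩, isEndPairA_erase_of_not_inspected hX h₁ h₂ hbx hqx (hnot q hq.1) hq.2⟩

open scoped Classical in
/-- **An uninspected end ball `x` is never read**: if no reader's dozen or mirrored dozen hits `x`, then `endMultA X x = 0`. -/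
theorem endMultA_eq_zero_of_not_inspected (h₁ : S₁.RT ⊆ fccSlots) (h₂ : S₂.RT ⊆ fccSlots) {x : EuclideanSpace ℝ (Fin 3)}
    (hnot : ∀ q ∈ X, ∀ G d, (S₁.Adm G d ∨ S₂.Adm G d) → IsEndMove X v G d q x → ¬ InspectedAt G q x x) :
    endMultA X v S₁ S₂ x = 0 := by
  unfold endMultA
  rw [card_eq_zero, filter_eq_empty_iff]
  rintro q hq ⟨-, -, -, G, d, hadm, -, hmove⟩
  apply hnot q hq G d hadm hmove
  obtain ⟨w₀, hw₀, hdw⟩ : ∃ w₀ ∈ fccSlots, -d = G w₀ := by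
    rcases hadm with h | h
    · exact (exists_slots_of_adm h₁ h).2
    · exact (exists_slots_of_adm h₂ h).2
  rcases hmove with ⟨-, hb, -⟩ | ⟨m, htw, -, hb, -⟩
  · refine ⟨-w₀, neg_mem_fccSlots hw₀, Or.inl ?_⟩
    rw [map_neg, ← hdw, neg_neg]; exact hb
  · refine ⟨w₀, hw₀, Or.inr (Or.inr ⟨m, htw.1, Or.inl ?_⟩)⟩
    rw [hb, ← hdw, inner_neg_left]
    simp only [mul_neg, neg_smul, sub_neg_eq_add]
    abel

open scoped Classical in
/-- Degrees with and without `x`: for `y ≠ x`, `deg_X y = deg_{X∖x} y + [dist y x = 1]`. -/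
theorem card_contacts_erase {x y : EuclideanSpace ℝ (Fin 3)} (hx : x ∈ X) :
    (X.filter fun q => dist y q = 1).card =
      ((X.erase x).filter fun q => dist y q = 1).card + (if dist y x = 1 then 1 else 0) := by
  rw [filter_erase]
  by_cases h : dist y x = 1
  · rw [if_pos h, card_erase_of_mem (mem_filter.2 ⟨hx, h⟩)]
    have : 0 < (X.filter fun q => dist y q = 1).card := card_pos.2 ⟨x, mem_filter.2 ⟨hx, h⟩⟩
    omega
  · have hnm : x ∉ X.filter (fun q => dist y q = 1) := fun hm => h (mem_filter.1 hm).2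
    rw [if_neg h, erase_eq_of_notMem hnm, add_zero]

open scoped Classical in
/-- **Pools lose at most one unit per contact of the removed ball**:
`pooledDef (X.erase x) b ≤ pooledDef X b + #{y ∈ X.erase x : dist x y = 1 ∧ dist b y ≤ 1}`. -/
theorem pooledDef_erase_le (hX : ∀ p ∈ X, ∀ q ∈ X, p ≠ q → 1 ≤ dist p q) {x : EuclideanSpace ℝ (Fin 3)} (hx : x ∈ X)
    (b : EuclideanSpace ℝ (Fin 3)) :
    pooledDef (X.erase x) b ≤ pooledDef X b + (((X.erase x).filter fun y => dist x y = 1 ∧ dist b y ≤ 1).card : ℝ) := by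
  -- the pool of `X.erase x`, termwise
  set P' := (X.erase x).filter fun y => dist b y ≤ 1 ∧ ((X.erase x).filter fun q => dist y q = 1).card ≤ 11 with hP'
  set f : EuclideanSpace ℝ (Fin 3) → ℝ := fun y =>
    if (X.filter fun q => dist y q = 1).card ≤ 11 then (12 : ℝ) - ((X.filter fun q => dist y q = 1).card : ℝ) else 0 with hf
  set g : EuclideanSpace ℝ (Fin 3) → ℝ := fun y => if dist x y = 1 then 1 else 0 with hg
  have hterm : ∀ y ∈ P', (12 : ℝ) - (((X.erase x).filter fun q => dist y q = 1).card : ℝ) ≤ f y + g y := by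
    intro y hy
    obtain ⟨hyE, -, hdeg'⟩ := mem_filter.1 hy
    have hyx : y ≠ x := (mem_erase.1 hyE).1
    have hrel := card_contacts_erase (y := y) hx
    have h12 := card_filter_dist_eq_one_le_twelve X hX y
    by_cases hxy : dist y x = 1
    · rw [if_pos hxy] at hrel
      have hxy' : dist x y = 1 := by rw [dist_comm]; exact hxy
      simp only [hf, hg, if_pos hxy']
      split_ifs with hle
      · have : ((X.filter fun q => dist y q = 1).card : ℝ) = (((X.erase x).filter fun q => dist y q = 1).card : ℝ) + 1 := by
          exact_mod_cast hrel
        linarith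
      · have : (X.filter fun q => dist y q = 1).card = 12 := by omega
        have h11 : ((X.erase x).filter fun q => dist y q = 1).card = 11 := by omega
        rw [h11]; norm_num
    · rw [if_neg hxy, add_zero] at hrel
      have hxy' : ¬ dist x y = 1 := by rw [dist_comm]; exact hxy
      simp only [hf, hg, if_neg hxy', add_zero]
      rw [if_pos (by rw [hrel]; exact hdeg'), hrel]
  -- sum up
  have hdef : pooledDef (X.erase x) b = ∑ y ∈ P', ((12 : ℝ) - (((X.erase x).filter fun q => dist y q = 1).card : ℝ)) := by
    unfold pooledDef; rfl
  have hsum : pooledDef (X.erase x) b ≤ ∑ y ∈ P', f y + ∑ y ∈ P', g y := by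
    rw [hdef, ← sum_add_distrib]; exact sum_le_sum hterm
  have hf_le : ∑ y ∈ P', f y ≤ pooledDef X b := by
    unfold pooledDef
    have hfnn : ∀ y, 0 ≤ f y := fun y => by
      simp only [hf]; split_ifs with h
      · have : ((X.filter fun q => dist y q = 1).card : ℝ) ≤ 11 := by exact_mod_cast h
        linarith
      · exact le_rfl
    calc ∑ y ∈ P', f y = ∑ y ∈ P'.filter (fun y => (X.filter fun q => dist y q = 1).card ≤ 11), f y +
          ∑ y ∈ P'.filter (fun y => ¬ (X.filter fun q => dist y q = 1).card ≤ 11), f y := (sum_filter_add_sum_filter_not _ _ _).symm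
      _ = ∑ y ∈ P'.filter (fun y => (X.filter fun q => dist y q = 1).card ≤ 11), f y := by
          rw [add_eq_left]
          exact sum_eq_zero fun y hy => by simp only [hf, if_neg (mem_filter.1 hy).2]
      _ ≤ ∑ y ∈ X.filter (fun y => dist b y ≤ 1 ∧ (X.filter fun q => dist y q = 1).card ≤ 11), f y := by
          refine sum_le_sum_of_subset_of_nonneg (fun y hy => ?_) fun y _ _ => hfnn y
          obtain ⟨hyP, hle⟩ := mem_filter.1 hy
          obtain ⟨hyE, hby, -⟩ := mem_filter.1 hyP
          exact mem_filter.2 ⟨(mem_erase.1 hyE).2, hby, hle⟩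
      _ = ∑ y ∈ X.filter (fun y => dist b y ≤ 1 ∧ (X.filter fun q => dist y q = 1).card ≤ 11),
            ((12 : ℝ) - ((X.filter fun q => dist y q = 1).card : ℝ)) :=
          sum_congr rfl fun y hy => by simp only [hf, if_pos (mem_filter.1 hy).2.2]
  have hg_le : ∑ y ∈ P', g y ≤ (((X.erase x).filter fun y => dist x y = 1 ∧ dist b y ≤ 1).card : ℝ) := by
    calc ∑ y ∈ P', g y = ((P'.filter fun y => dist x y = 1).card : ℝ) := by
          simp only [hg]; rw [Finset.sum_boole]
      _ ≤ (((X.erase x).filter fun y => dist x y = 1 ∧ dist b y ≤ 1).card : ℝ) := by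
          exact_mod_cast card_le_card fun y hy => by
            obtain ⟨hyP, hxy⟩ := mem_filter.1 hy
            obtain ⟨hyE, hby, -⟩ := mem_filter.1 hyP
            exact mem_filter.2 ⟨hyE, hxy, hby⟩
  linarith

open scoped Classical in
/-- **THE JAMMED-BALL COMPARISON.**  Let `x ∈ X` touch at most three balls and sit at no inspected position of any reader of a ball within `1` of
the payer `z ≠ x`; write `e', p'` for the (A)-multiplicities and pools of `X.erase x` and `c(b)` for the number of contacts of `x` within `1` of `b`.
If `p'(b) > c(b)` at every ball within `1` of `z`, then `Σ_A(X, z) ≤ Σ_b e'(b) / (p'(b) − c(b))`. -/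
theorem localSummandA_le_of_jammed (hX : ∀ p ∈ X, ∀ q ∈ X, p ≠ q → 1 ≤ dist p q) (h₁ : S₁.RT ⊆ fccSlots) (h₂ : S₂.RT ⊆ fccSlots)
    {x z : EuclideanSpace ℝ (Fin 3)} (hx : x ∈ X) (hfew : (X.filter fun q => dist x q = 1).card ≤ 3)
    (hnot : ∀ b ∈ X, dist z b ≤ 1 → ∀ q ∈ X, ∀ G d, (S₁.Adm G d ∨ S₂.Adm G d) → IsEndMove X v G d q b → ¬ InspectedAt G q b x)
    (hpos : ∀ b ∈ X.erase x, dist z b ≤ 1 →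
      (((X.erase x).filter fun y => dist x y = 1 ∧ dist b y ≤ 1).card : ℝ) < pooledDef (X.erase x) b) :
    localSummandA v S₁ S₂ X z ≤
      ∑ b ∈ (X.erase x).filter (fun b => dist z b ≤ 1 ∧ 0 < endMultA (X.erase x) v S₁ S₂ b),
        (endMultA (X.erase x) v S₁ S₂ b : ℝ) /
          (pooledDef (X.erase x) b - (((X.erase x).filter fun y => dist x y = 1 ∧ dist b y ≤ 1).card : ℝ)) := by
  unfold localSummandA
  set F := X.filter (fun b => dist z b ≤ 1 ∧ 0 < endMultA X v S₁ S₂ b) with hF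
  set F' := (X.erase x).filter (fun b => dist z b ≤ 1 ∧ 0 < endMultA (X.erase x) v S₁ S₂ b) with hF'
  set g : EuclideanSpace ℝ (Fin 3) → ℝ := fun b => (endMultA (X.erase x) v S₁ S₂ b : ℝ) /
    (pooledDef (X.erase x) b - (((X.erase x).filter fun y => dist x y = 1 ∧ dist b y ≤ 1).card : ℝ)) with hg
  have key : ∀ b ∈ F, b ∈ F' ∧ (endMultA X v S₁ S₂ b : ℝ) / pooledDef X b ≤ g b := by
    intro b hb
    obtain ⟨hbX, hzb, hepos⟩ := mem_filter.1 hb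
    have hnotb := hnot b hbX hzb
    have hbx : b ≠ x := by
      rintro rfl
      have h0 := endMultA_eq_zero_of_not_inspected (v := v) h₁ h₂ hnotb
      omega
    have hbE : b ∈ X.erase x := mem_erase.2 ⟨hbx, hbX⟩
    have hle := endMultA_le_erase hX h₁ h₂ hbx hfew hnotb
    have hp := pooledDef_erase_le hX hx b
    have hc := hpos b hbE hzb
    refine ⟨mem_filter.2 ⟨hbE, hzb, lt_of_lt_of_le hepos hle⟩, ?_⟩
    have hden : pooledDef (X.erase x) b - (((X.erase x).filter fun y => dist x y = 1 ∧ dist b y ≤ 1).card : ℝ) ≤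
        pooledDef X b := by linarith
    have hdenpos : 0 < pooledDef (X.erase x) b - (((X.erase x).filter fun y => dist x y = 1 ∧ dist b y ≤ 1).card : ℝ) := by
      linarith
    have hleR : (endMultA X v S₁ S₂ b : ℝ) ≤ (endMultA (X.erase x) v S₁ S₂ b : ℝ) := by exact_mod_cast hle
    calc (endMultA X v S₁ S₂ b : ℝ) / pooledDef X b
        ≤ (endMultA (X.erase x) v S₁ S₂ b : ℝ) / pooledDef X b :=
          div_le_div_of_nonneg_right hleR (hdenpos.le.trans hden)
      _ ≤ g b := div_le_div_of_nonneg_left (Nat.cast_nonneg _) hdenpos hden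
  have hsub : F ⊆ F' := fun b hb => (key b hb).1
  have hgnn : ∀ b ∈ F', 0 ≤ g b := by
    intro b hb
    obtain ⟨hbE, hzb, -⟩ := mem_filter.1 hb
    exact div_nonneg (Nat.cast_nonneg _) (by linarith [hpos b hbE hzb])
  calc ∑ b ∈ F, (endMultA X v S₁ S₂ b : ℝ) / pooledDef X b ≤ ∑ b ∈ F, g b := sum_le_sum fun b hb => (key b hb).2
    _ ≤ ∑ b ∈ F', g b := sum_le_sum_of_subset_of_nonneg hsub fun b hb _ => hgnn b hb


end Jammed

end TailResidue

end Summit.Ventures.Crystal3D.Theorems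

end
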